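import Summits.BirchSwinnertonDyer.BirchSwinnertonDyer.Theorems.EisensteinPrimesWeakLeopoldtAboveOfSqueeze
import Summits.BirchSwinnertonDyer.BirchSwinnertonDyer.Theorems.EisensteinPrimesAcTwistDeformationSURRankOfTate
import Summits.BirchSwinnertonDyer.BirchSwinnertonDyer.Theorems.EisensteinPrimesWeakLeopoldtAboveOfTate
import Literature.NumberTheory.IwasawaTheory.Greenberg2006.CohomologyCofiniteGenerationLeTwoOfTate
import HarnessLib

/-!
# T28 re-typing (`OfTate`) of `EisensteinPrimesWeakLeopoldtAboveOfSqueeze.lean`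

Route `EisensteinPrimes` (rung K5), crux 2 `GoodLatticeBDPValue` (stmt-BirchSwinnertonDyer-19032), line `halves`;
cell `bsd-eis`, seat `bsd-line-x1-p1` LEAD g8, lane «T28 / TATE RE-PLUMB» (helper, `--supports`).

This file re-types, token for token, the theorems of `EisensteinPrimesWeakLeopoldtAboveOfSqueeze` that carry
Greenberg 2006 Prop. 3.2 BY NAME (`h32 : (∀ (L : Type) [Field L] [NumberField L], Literature.NumberTheory.GaloisCohomology.tateGlobalEulerPoincareCharacteristic L)`, cofinite generation of
`Hⁱ(K_Σ/K, 𝒟)` / `Hⁱ(K_v, 𝒟)` for EVERY `i`, every number field, every prime) with that hypothesis replaced by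
Tate's global Euler–Poincaré characteristic BY NAME for every number field
(`h32 : ∀ L, GaloisCohomology.tateGlobalEulerPoincareCharacteristic L`, Milne ADT I Thm. 5.1): on this line
Prop. 3.2 is read in degrees `i ≤ 2` only (global clause; the local clause is the unconditional
`Greenberg2006.prop32_local_holds`), and in those degrees it follows from Tate's formula alone
(`Greenberg2006.prop32_global_le_two_of_tate`, file `CohomologyCofiniteGenerationLeTwoOfTate`: `H⁰`/`H¹` of
`G_{K,S}` with finite coefficients are finite unconditionally, `H²` by Tate, and Greenberg's dévissage for `Hⁿ`
involves `Hⁿ`, `Hⁿ⁻¹` only).  Statements are otherwise VERBATIM (same binder order, new names `<name>_ofTate`);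
proofs are the tree proofs with the two reading lemmas substituted and the re-typed callees called.
EFFECT for the crux: Harari Thm. 17.13 (a) (`poitouTate_restricted_three_le`) is no longer consumed through
Prop. 3.2 at every number field, only at totally complex fields (Greenberg 2006 Prop. 4.1 is typed totally
imaginary; `cd_p ≤ 2` and the `H²` bookkeeping at the imaginary quadratic `K`), which is what the tree's
class-formation road (`RestrictedRamificationCdTwoOfH3Mu`, lane PT3-TC) proves.

Theorems only; no definition, no named fact, no `sorry`, no instance. HONEST FRAMING: conditional on the PUBLISHED
named facts carried as hypotheses; closes nothing by itself; no summit statement / BSD / the crux is proved here.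

## References
* R. Greenberg, *On the structure of certain Galois cohomology groups*, Doc. Math. Extra Vol. Coates (2006), Prop. 3.2 (p. 358). [Greenberg2006]
* J. S. Milne, *Arithmetic Duality Theorems*, 2nd ed. (2006), I Thm. 5.1 (p. 67). [MilneADT2006]
* (the references of the re-typed file apply verbatim)
-/

set_option autoImplicit false

noncomputable section

open scoped Classical
open NumberField IsDedekindDomain Field
open Literature.NumberTheory.GaloisRepresentations Literature.NumberTheory.GaloisCohomology
open Literature.NumberTheory.EllipticCurves (ZpExtension BigRepModule bigRep IsImaginaryQuadratic)
open Literature.NumberTheory.IwasawaTheory Literature.NumberTheory.IwasawaTheory.Greenberg2016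
  Literature.NumberTheory.IwasawaTheory.Greenberg2006
open Summit.BirchSwinnertonDyer.BirchSwinnertonDyer.Theorems.AcTwistDeformation
  Summit.BirchSwinnertonDyer.BirchSwinnertonDyer.Theorems.WeakLeopoldtAbove

namespace Summit.BirchSwinnertonDyer.BirchSwinnertonDyer.Theorems.WeakLeopoldtAboveOfSqueeze

variable {K : Type} [Field K] [NumberField K] {S : Set (HeightOneSpectrum (𝓞 K))} {p : ℕ} [Fact p.Prime]
  {A : Type} [AddCommGroup A] [Module ℤ_[p] A] [TopologicalSpace A] [DiscreteTopology A] [ContinuousSMul ℤ_[p] A]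
  [TopologicalSpace (PowerSeries ℤ_[p])] [IsTopologicalRing (PowerSeries ℤ_[p])]
  [IsTopologicalAddGroup (BigRepModule ℤ_[p] p A)]
  [ContinuousSMul (PowerSeries ℤ_[p]) (BigRepModule ℤ_[p] p A)]
  (hS : ∀ v : HeightOneSpectrum (𝓞 K), ((p : ℕ) : 𝓞 K) ∈ v.asIdeal → v ∈ S)
  (κ : ZpExtension K p) (ρ₀ : ContinuousRep (GaloisGroupUnramifiedOutside K S) ℤ_[p] A)

section Pi

variable {n : ℕ}

omit [ContinuousSMul ℤ_[p] A] in
/-- **[T28 `OfTate` re-typing: Greenberg 2006 Prop. 3.2 by name ↦ Milne ADT I Thm. 5.1 by name (Prop. 3.2 is read in degrees ≤ 2 only, `prop32_global_le_two_of_tate`).]** [cite: MilneADT2006, I Thm. 5.1 (p. 67)] **`H²(K_Σ/K, 𝐃₁) = 0` from the corank squeeze**, `A ≃ₗ[ℤ_p] (ℚ_p/ℤ_p)ⁿ`, `K` imaginary quadratic with `p = 𝔭𝔭̄`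
split: the hypotheses of w3 g3's `bigRep_leo_crk_pi_ofTate` (Greenberg 2006 Props. 4.1, 4.2, §5 A, 3.2 by name; `h⁰_loc = 0`
and LOC⁽¹⁾ at the places of `S`; `corank_Λ S_{𝓛_𝔭}(K, 𝐃₁) = 0`) give `corank H²(K_Σ/K, 𝐃₁) = 0`, and `cd_p(G_{K,Σ}) ≤ 2`
(PUB, `p ≠ 2`) with cofreeness of `𝐃₁` upgrades it to vanishing (`…WeakLeopoldtAbove`).
[cite: Greenberg2006, Props. 4.1–4.2 (§4 A pp. 367–368), §5 A, Props. 3.2–3.6 pp. 358–360]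
[cite: Greenberg2016Selmer, §2.2–2.3 pp. 6–7] [cite: NeukirchSchmidtWingberg2008, (8.3.18)] -/
theorem subsingleton_H_two_bigRep_of_squeeze_pi_ofTate (hCD2 : groupCdLE_two_galoisGroupUnramifiedOutside K)
    (h41 : prop41_globalEulerPoincareCorank) (h42 : prop42_localEulerPoincareCorank)
    (h5A : sec5A_localH2_subsingleton_of_LOC1) (h32 : (∀ (L : Type) [Field L] [NumberField L], Literature.NumberTheory.GaloisCohomology.tateGlobalEulerPoincareCharacteristic L)) (hp2 : p ≠ 2)
    (hSf : S.Finite) (hK : IsImaginaryQuadratic K) (e : A ≃ₗ[ℤ_[p]] (Fin n → QpModZp p))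
    (h0loc : ∀ v : HeightOneSpectrum (𝓞 K), v ∈ S →
      HasCorank (PowerSeries ℤ_[p])
        ((localRep S (bigRep (κ.liftUnramifiedOutside S hS) ρ₀) (Sum.inr v)).H 0) 0)
    (hLOC1fin : ∀ v : HeightOneSpectrum (𝓞 K), v ∈ S →
      LOC1 S (bigRep (κ.liftUnramifiedOutside S hS) ρ₀) (Sum.inr v))
    {𝔭 𝔭bar : HeightOneSpectrum (𝓞 K)} (hne : 𝔭bar ≠ 𝔭)
    (hp𝔭 : ((p : ℕ) : 𝓞 K) ∈ 𝔭.asIdeal) (hp𝔭bar : ((p : ℕ) : 𝓞 K) ∈ 𝔭bar.asIdeal)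
    (hSel : HasCorank (PowerSeries ℤ_[p])
      (fullAtSpecification S (bigRep (κ.liftUnramifiedOutside S hS) ρ₀) (Sum.inr 𝔭)).selmer 0) :
    Subsingleton ((bigRep (κ.liftUnramifiedOutside S hS) ρ₀).H 2) := by
  obtain ⟨hA, jQ, hinj, hsurj⟩ := exists_pi_character_hinj_hsurj_of_linearEquiv e
  exact subsingleton_H_two_bigRep_of_facts_ofTate S hS κ ρ₀ hCD2 h32 hp2 hSf (isCofree_bigRepModule_pi hA jQ hinj hsurj)
    (bigRep_leo_crk_pi_ofTate hS κ ρ₀ h41 h42 h5A h32 hSf hK e h0loc hLOC1fin hne hp𝔭 hp𝔭bar hSel).2.2.2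

/-- **[T28 `OfTate` re-typing: Greenberg 2006 Prop. 3.2 by name ↦ Milne ADT I Thm. 5.1 by name (Prop. 3.2 is read in degrees ≤ 2 only, `prop32_global_le_two_of_tate`).]** [cite: MilneADT2006, I Thm. 5.1 (p. 67)] **WEAK LEOPOLDT ABOVE `K_∞` FROM THE SQUEEZE, `A ≃ₗ[ℤ_p] (ℚ_p/ℤ_p)ⁿ`: `H²(Gal(K_Σ/K_∞), A) = 0`** (e.g. `A = E[p^∞]`,
`n = 2`: WL_f of the V21 road), under the hypotheses of `bigRep_leo_crk_pi_ofTate` + CD2 + `p ≠ 2`.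
[cite: Greenberg2006, Thm. 3 p. 342, Props. 4.1–4.2 pp. 367–368, §5 A, Props. 3.2–3.6 pp. 358–360]
[cite: Greenberg2016Selmer, §2.2–2.3 pp. 6–7] [cite: NeukirchSchmidtWingberg2008, (8.3.18)] -/
theorem subsingleton_H_two_above_of_squeeze_pi_ofTate (hCD2 : groupCdLE_two_galoisGroupUnramifiedOutside K)
    (h41 : prop41_globalEulerPoincareCorank) (h42 : prop42_localEulerPoincareCorank)
    (h5A : sec5A_localH2_subsingleton_of_LOC1) (h32 : (∀ (L : Type) [Field L] [NumberField L], Literature.NumberTheory.GaloisCohomology.tateGlobalEulerPoincareCharacteristic L)) (hp2 : p ≠ 2)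
    (hSf : S.Finite) (hK : IsImaginaryQuadratic K) (e : A ≃ₗ[ℤ_[p]] (Fin n → QpModZp p))
    (h0loc : ∀ v : HeightOneSpectrum (𝓞 K), v ∈ S →
      HasCorank (PowerSeries ℤ_[p])
        ((localRep S (bigRep (κ.liftUnramifiedOutside S hS) ρ₀) (Sum.inr v)).H 0) 0)
    (hLOC1fin : ∀ v : HeightOneSpectrum (𝓞 K), v ∈ S →
      LOC1 S (bigRep (κ.liftUnramifiedOutside S hS) ρ₀) (Sum.inr v))
    {𝔭 𝔭bar : HeightOneSpectrum (𝓞 K)} (hne : 𝔭bar ≠ 𝔭)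
    (hp𝔭 : ((p : ℕ) : 𝓞 K) ∈ 𝔭.asIdeal) (hp𝔭bar : ((p : ℕ) : 𝓞 K) ∈ 𝔭bar.asIdeal)
    (hSel : HasCorank (PowerSeries ℤ_[p])
      (fullAtSpecification S (bigRep (κ.liftUnramifiedOutside S hS) ρ₀) (Sum.inr 𝔭)).selmer 0) :
    Subsingleton ((ρ₀.restrict (galoisGroupAboveSubtype S κ.kerSubgroup)).H 2) :=
  subsingleton_H_two_above_of_linearEquiv_pi_ofTate S hS κ ρ₀ hCD2 h32 hp2 hSf e
    (bigRep_leo_crk_pi_ofTate hS κ ρ₀ h41 h42 h5A h32 hSf hK e h0loc hLOC1fin hne hp𝔭 hp𝔭bar hSel).2.2.2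

end Pi

section Character

/-- **[T28 `OfTate` re-typing: Greenberg 2006 Prop. 3.2 by name ↦ Milne ADT I Thm. 5.1 by name (Prop. 3.2 is read in degrees ≤ 2 only, `prop32_global_le_two_of_tate`).]** [cite: MilneADT2006, I Thm. 5.1 (p. 67)] **WEAK LEOPOLDT ABOVE `K_∞` FOR A CHARACTER, from the squeeze: `H²(Gal(K_Σ/K_∞), A) = 0`** for `A ≃ₗ[ℤ_p] ℚ_p/ℤ_p`
on which `G_{K,S}` acts by scalars (e.g. `ℚ_p/ℤ_p(θ) ≅ (F/𝒪)(θ)`, `θ ∈ {θsub, θquot}`: WL_ω / WL_1 of the V21 road),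
over a `ℤ_p`-extension `κ` of an IMAGINARY QUADRATIC `K` with `p = 𝔭𝔭̄` split, no place of `S` splitting completely in
`K_∞` (`hsup`), granted Greenberg 2006 Props. 4.1, 4.2, §5 A, 3.2 and CD2 BY NAME and `corank_Λ S_{𝓛_𝔭}(K, 𝐃₁) = 0`
— i.e. the hypotheses of LEAD g2's `bigRep_fullAt_SUR_ofTate` minus Prop. 2.6.3 / `hSelfg`, plus CD2 / `p ≠ 2`.
[cite: Greenberg2006, Thm. 3 p. 342, Props. 4.1–4.2 pp. 367–368, §5 A, Props. 3.2–3.6 pp. 358–360]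
[cite: Greenberg2016Selmer, §2.2–2.3 pp. 6–7] [cite: Greenberg2010, Lemma 5.2.2] [cite: NeukirchSchmidtWingberg2008, (8.3.18)] -/
theorem subsingleton_H_two_above_of_squeeze_character_ofTate (hCD2 : groupCdLE_two_galoisGroupUnramifiedOutside K)
    (h41 : prop41_globalEulerPoincareCorank) (h42 : prop42_localEulerPoincareCorank)
    (h5A : sec5A_localH2_subsingleton_of_LOC1) (h32 : (∀ (L : Type) [Field L] [NumberField L], Literature.NumberTheory.GaloisCohomology.tateGlobalEulerPoincareCharacteristic L)) (hp2 : p ≠ 2)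
    (hSf : S.Finite) (hK : IsImaginaryQuadratic K) (e : A ≃ₗ[ℤ_[p]] QpModZp p)
    (hscalar : ∀ g : GaloisGroupUnramifiedOutside K S, ∃ t : ℤ_[p]ˣ, ∀ a : A, ρ₀ g a = (t : ℤ_[p]) • a)
    (hsup : ∀ v : HeightOneSpectrum (𝓞 K), v ∈ S →
      ∃ σ : absoluteGaloisGroup (Place.Completion (Sum.inr v : Place K)), κ (absGaloisRestrict K _ σ) ≠ 1)
    {𝔭 𝔭bar : HeightOneSpectrum (𝓞 K)} (hne : 𝔭bar ≠ 𝔭)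
    (hp𝔭 : ((p : ℕ) : 𝓞 K) ∈ 𝔭.asIdeal) (hp𝔭bar : ((p : ℕ) : 𝓞 K) ∈ 𝔭bar.asIdeal)
    (hSel : HasCorank (PowerSeries ℤ_[p])
      (fullAtSpecification S (bigRep (κ.liftUnramifiedOutside S hS) ρ₀) (Sum.inr 𝔭)).selmer 0) :
    Subsingleton ((ρ₀.restrict (galoisGroupAboveSubtype S κ.kerSubgroup)).H 2) := by
  obtain ⟨e₁⟩ := nonempty_linearEquiv_pi_one e
  obtain ⟨h0loc, hLOC1fin⟩ := h0loc_and_LOC1_of_scalar hS κ ρ₀ e hscalar hsup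
  exact subsingleton_H_two_above_of_squeeze_pi_ofTate hS κ ρ₀ hCD2 h41 h42 h5A h32 hp2 hSf hK e₁ h0loc hLOC1fin hne hp𝔭
    hp𝔭bar hSel

omit [ContinuousSMul ℤ_[p] A] in
/-- **[T28 `OfTate` re-typing: Greenberg 2006 Prop. 3.2 by name ↦ Milne ADT I Thm. 5.1 by name (Prop. 3.2 is read in degrees ≤ 2 only, `prop32_global_le_two_of_tate`).]** [cite: MilneADT2006, I Thm. 5.1 (p. 67)] The `K`-side form for a character: **`H²(K_Σ/K, 𝐃₁) = 0`** under the same hypotheses.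
[cite: Greenberg2006, Props. 4.1–4.2 pp. 367–368, §5 A, Props. 3.2–3.6 pp. 358–360] [cite: Greenberg2016Selmer, §2.2–2.3 pp. 6–7] -/
theorem subsingleton_H_two_bigRep_of_squeeze_character_ofTate (hCD2 : groupCdLE_two_galoisGroupUnramifiedOutside K)
    (h41 : prop41_globalEulerPoincareCorank) (h42 : prop42_localEulerPoincareCorank)
    (h5A : sec5A_localH2_subsingleton_of_LOC1) (h32 : (∀ (L : Type) [Field L] [NumberField L], Literature.NumberTheory.GaloisCohomology.tateGlobalEulerPoincareCharacteristic L)) (hp2 : p ≠ 2)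
    (hSf : S.Finite) (hK : IsImaginaryQuadratic K) (e : A ≃ₗ[ℤ_[p]] QpModZp p)
    (hscalar : ∀ g : GaloisGroupUnramifiedOutside K S, ∃ t : ℤ_[p]ˣ, ∀ a : A, ρ₀ g a = (t : ℤ_[p]) • a)
    (hsup : ∀ v : HeightOneSpectrum (𝓞 K), v ∈ S →
      ∃ σ : absoluteGaloisGroup (Place.Completion (Sum.inr v : Place K)), κ (absGaloisRestrict K _ σ) ≠ 1)
    {𝔭 𝔭bar : HeightOneSpectrum (𝓞 K)} (hne : 𝔭bar ≠ 𝔭)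
    (hp𝔭 : ((p : ℕ) : 𝓞 K) ∈ 𝔭.asIdeal) (hp𝔭bar : ((p : ℕ) : 𝓞 K) ∈ 𝔭bar.asIdeal)
    (hSel : HasCorank (PowerSeries ℤ_[p])
      (fullAtSpecification S (bigRep (κ.liftUnramifiedOutside S hS) ρ₀) (Sum.inr 𝔭)).selmer 0) :
    Subsingleton ((bigRep (κ.liftUnramifiedOutside S hS) ρ₀).H 2) := by
  obtain ⟨e₁⟩ := nonempty_linearEquiv_pi_one e
  obtain ⟨h0loc, hLOC1fin⟩ := h0loc_and_LOC1_of_scalar hS κ ρ₀ e hscalar hsup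
  exact subsingleton_H_two_bigRep_of_squeeze_pi_ofTate hS κ ρ₀ hCD2 h41 h42 h5A h32 hp2 hSf hK e₁ h0loc hLOC1fin hne hp𝔭
    hp𝔭bar hSel

end Character

end Summit.BirchSwinnertonDyer.BirchSwinnertonDyer.Theorems.WeakLeopoldtAboveOfSqueeze

end
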